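/-
Copyright: statement-level skeleton of a published paper (lit-balaban cell, reader/typer r15). No proof claims beyond
what the kernel checks below.
-/
import Mathlib
import Literature.MathematicalPhysics.QuantumFieldTheory.Balaban1983to89.LatticeNorms

/-!
# B3 — T. Bałaban, *(Higgs)₂,₃ quantum fields in a finite volume. III. Renormalization*, CMP **88** (1983) 411–445,
Sect. 1: the counterterm bookkeeping (1.25)–(1.28), the final scale `K` (p. 418) and the norm (1.32)

statement-level skeleton of published theorems with citation tags; proofs where landed; nothing here is a claim about
the Yang–Mills mass gap

Source: held text `paper:balaban1983-higgs-2-3-quantum-fields-finite-volume` (journal page = PDF page + 410), render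
`pub-balaban/b2b-balaban-ref1/pages/1983-cmp88-higgs23-III/…-p008-x2.png` (p. 418) read as an image for (1.25)–(1.28).
Companion files: `B3Prop1` (Prop. 1, Props. 2.1–2.2, vertex catalogue (1.6)–(1.15)), `B3Sect2Statements`,
`B3Sect2StatementsPart2`, `B3Sect3Statements`, and `B3` ((2.6)–(2.7)).

## What is typed here, and how

* **p. 418, the final scale.** *"we finish our procedure for k = K, K is defined by the conditions L^K ε ≤ ε₀,
  L^{K+1} ε > ε₀, where ε₀ > 0 is some fixed sufficiently small number, independent of ε, T_ε."* — `IsFinalScale`,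
  with existence and uniqueness PROVED for `1 < L`, `0 < ε ≤ ε₀` (`exists_isFinalScale`, `isFinalScale_unique`).
* **(1.25)** *"G^ε_K(0) = (−Δ^ε_0 + m² + a_K(L^Kε)^{−2}P_K)^{−1} … We have C^ε_0 = G^ε_K(0) + a_K(L^Kε)^{−2}G^ε_K(0)P_K C^ε_0,
  (1.25)"* with C^ε_0 = (−Δ^ε_0 + m²)^{−1} (p. 416) — PROVED as the resolvent identity it is, in an arbitrary ring
  (`eq125`: if `c⁻¹ c = 1` and `g (c⁻¹ + x) = 1` then `c = g + g x c`, here x = a_K(L^Kε)^{−2}P_K).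
* **(1.27)** *"[the normalization group equation (I.2.43)] G^ε_K(0) = Σ_{j=1}^{K−1} a_j²(L^jε)^{−4}G^ε_j(0)Q_j^*
  C^{(j),L^jε}(0)Q_jG^ε_j(0) + C^{(0),ε}(0) = G^ε_k(0) + Σ_{j=k}^{K−1} a_j²(L^jε)^{−4}(…) = G^ε_k(0) + G^ε_{K,k}(0), (1.27)"*
  — the tail `G_{K,k}` is `tailPiece`, and the second/third equality is PROVED from the (I.2.43) form (`eq127`), in an
  arbitrary additive commutative monoid of operators (same typed reading as `B1.display243_of_242`, `B3.Display26`).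
* **(1.26), (1.28)** *"δm² = δm²_fin(x) + δm²_K(x), E₁ = E_fin + E_K, (1.26)"*, *"δm²_K(x) = δm²_{K,k}(x) + δm²_k(x),
  E_K = E_{K,k} + E_k, (1.28) where δm²_k(x), E_k have the same form as δm²_K(x), E_K, only the propagators are
  replaced by G^ε_k(0), G^ε_k correspondingly, and δm²_{K,k}(x), E_{K,k} are formed by the remaining terms."* — the
  bookkeeping content of (1.28) is PROVED for a graph expression that is MULTILINEAR in the propagators of its lines
  (`eq128`: substituting G_K = G_k + G_{K,k} on every line, the all-`G_k` term splits off and "the remaining terms" are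
  the sum over the proper subsets of lines carrying `G_k`; kernel: `MultilinearMap.map_add_univ`).  (1.26) is the
  same splitting one level up and is not typed separately; the graph expansions defining δm², E₁ ((1.19)–(1.24)) are
  not modelled.
* **(1.32)** *"‖f‖_{1,α} = sup_x |f(x)| + sup_{x,μ} |(D^η_{B,μ}f)(x)| + sup_{x,x′,μ} |x − x′|^{−α}
  |U(B(Γ_{x,x′}))(D^η_{B,μ}f)(x′) − (D^η_{B,μ}f)(x)|, (1.32) where Γ_{x,x′} is a shortest contour connecting x and
  x′. … For external vector fields we have the same definition, but with B = 0."* — `norm132`, the printed SUM form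
  assembled from the shared ingredients of `LatticeNorms` (`supNorm`, `holderSeminorm`; the covariant derivative
  family `Df` and the transport `τ` = U(B(Γ_{x,x′})) are supplied by the user exactly as in `LatticeNorms.holderNormOne`,
  which is the MAX form of B4 (2.14)); PROVED: `holderNormOne ≤ norm132 ≤ 3 · holderNormOne`.
-/

open scoped BigOperators

namespace Literature.MathematicalPhysics.QuantumFieldTheory.Balaban1983to89.B3Sect1Statements

/-! ### p. 418 — the final scale K -/

/-- p. 418 [PDF 8]: *"we finish our procedure for k = K, K is defined by the conditions L^K ε ≤ ε₀, L^{K+1} ε > ε₀,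
where ε₀ > 0 is some fixed sufficiently small number, independent of ε, T_ε."*
[cite: Balaban1983Higgs3, p.418] -/
def IsFinalScale (L ε ε₀ : ℝ) (K : ℕ) : Prop :=
  L ^ K * ε ≤ ε₀ ∧ ε₀ < L ^ (K + 1) * ε

/-- Existence of the final scale for `1 < L`, `0 < ε ≤ ε₀`. [cite: Balaban1983Higgs3, p.418] -/
theorem exists_isFinalScale {L ε ε₀ : ℝ} (hL : 1 < L) (hε : 0 < ε) (hεε₀ : ε ≤ ε₀) :
    ∃ K : ℕ, IsFinalScale L ε ε₀ K := by
  classical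
  have hex : ∃ n : ℕ, ε₀ < L ^ (n + 1) * ε := by
    obtain ⟨n, hn⟩ := pow_unbounded_of_one_lt (ε₀ / ε) hL
    refine ⟨n, ?_⟩
    have h1 : ε₀ < L ^ n * ε := by rwa [div_lt_iff₀ hε] at hn
    have h2 : L ^ n * ε ≤ L ^ (n + 1) * ε :=
      mul_le_mul_of_nonneg_right (pow_le_pow_right₀ hL.le (Nat.le_succ n)) hε.le
    exact lt_of_lt_of_le h1 h2
  refine ⟨Nat.find hex, ?_, Nat.find_spec hex⟩
  rcases Nat.eq_zero_or_pos (Nat.find hex) with h0 | hpos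
  · rw [h0]; simpa using hεε₀
  · obtain ⟨k, hk⟩ : ∃ k, Nat.find hex = k + 1 := ⟨Nat.find hex - 1, by omega⟩
    have hmin : ¬ (ε₀ < L ^ (k + 1) * ε) := Nat.find_min hex (by omega)
    rw [hk]
    exact not_lt.mp hmin

/-- Uniqueness of the final scale (for `1 < L`, `0 < ε`). [cite: Balaban1983Higgs3, p.418] -/
theorem isFinalScale_unique {L ε ε₀ : ℝ} (hL : 1 < L) (hε : 0 < ε) {K K' : ℕ}
    (hK : IsFinalScale L ε ε₀ K) (hK' : IsFinalScale L ε ε₀ K') : K = K' := by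
  by_contra hne
  rcases Nat.lt_or_gt_of_ne hne with hlt | hgt
  · have h1 : L ^ (K + 1) * ε ≤ L ^ K' * ε :=
      mul_le_mul_of_nonneg_right (pow_le_pow_right₀ hL.le (by omega)) hε.le
    exact absurd (lt_of_lt_of_le (lt_of_lt_of_le hK.2 h1) hK'.1) (lt_irrefl _)
  · have h1 : L ^ (K' + 1) * ε ≤ L ^ K * ε :=
      mul_le_mul_of_nonneg_right (pow_le_pow_right₀ hL.le (by omega)) hε.le
    exact absurd (lt_of_lt_of_le (lt_of_lt_of_le hK'.2 h1) hK.1) (lt_irrefl _)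

/-! ### (1.25) — the resolvent identity relating C^ε_0 and G^ε_K(0) -/

/-- **(1.25)** p. 418 [PDF 8]: *"G^ε_K(0) = (−Δ^ε_0 + m² + a_K(L^Kε)^{−2}P_K)^{−1} … We have
C^ε_0 = G^ε_K(0) + a_K(L^Kε)^{−2}G^ε_K(0)P_K C^ε_0, (1.25) similarly for C^ε"* (C^ε_0 = (−Δ^ε_0 + m²)^{−1}, p. 416).
Typed reading, in an arbitrary ring of operators: `c` = C^ε_0 with left inverse `cinv` = −Δ^ε_0 + m²,
`x` = a_K(L^Kε)^{−2}P_K, and `g` = G^ε_K(0) a right inverse of `cinv + x`; then (1.25).  PROVED.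
[cite: Balaban1983Higgs3, (1.25) p.418] -/
theorem eq125 {R : Type*} [Ring R] (c cinv g x : R) (hc : cinv * c = 1) (hg : g * (cinv + x) = 1) :
    c = g + g * x * c := by
  calc c = 1 * c := (one_mul c).symm
    _ = g * (cinv + x) * c := by rw [hg]
    _ = g + g * x * c := by rw [mul_add, add_mul, mul_assoc g cinv c, hc, mul_one]

/-! ### (1.27) — the normalization group equation and its splitting at level k -/

/-- **(1.27)** p. 418, the tail *"G^ε_{K,k}(0) = Σ_{j=k}^{K−1} a_j²(L^jε)^{−4}G^ε_j(0)Q_j^*C^{(j),L^jε}(0)Q_jG^ε_j(0)"*: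
`T j` is the j-th summand, in an arbitrary additive commutative monoid of operators.
[cite: Balaban1983Higgs3, (1.27) p.418] -/
def tailPiece {R : Type*} [AddCommMonoid R] (T : ℕ → R) (k K : ℕ) : R :=
  ∑ j ∈ Finset.Ico k K, T j

/-- **(1.27)** p. 418 [PDF 8]: *"G^ε_K(0) = Σ_{j=1}^{K−1} a_j²(L^jε)^{−4}G^ε_j(0)Q_j^*C^{(j),L^jε}(0)Q_jG^ε_j(0)
+ C^{(0),ε}(0) = G^ε_k(0) + Σ_{j=k}^{K−1} a_j²(L^jε)^{−4}G^ε_j(0)Q_j^*C^{(j),L^jε}(0)Q_jG^ε_j(0) = G^ε_k(0) + G^ε_{K,k}(0),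
(1.27) and the same for G^ε_K."*  PROVED from the (I.2.43) form `h` (valid at every level `n ≥ 1`; cf.
`B1.display243_of_242`), for `1 ≤ k ≤ K`. [cite: Balaban1983Higgs3, (1.27) p.418] -/
theorem eq127 {R : Type*} [AddCommMonoid R] (G T : ℕ → R) (C0 : R)
    (h : ∀ n : ℕ, 1 ≤ n → G n = (∑ j ∈ Finset.Ico 1 n, T j) + C0) {k K : ℕ} (hk : 1 ≤ k) (hkK : k ≤ K) :
    G K = G k + tailPiece T k K := by
  rw [h K (hk.trans hkK), h k hk, tailPiece, ← Finset.sum_Ico_consecutive T hk hkK]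
  abel

/-- (1.27) at `k = K`: the tail is empty. [cite: Balaban1983Higgs3, (1.27) p.418] -/
theorem tailPiece_self {R : Type*} [AddCommMonoid R] (T : ℕ → R) (K : ℕ) : tailPiece T K K = 0 := by
  simp [tailPiece]

/-! ### (1.28) — "δm²_{K,k}(x), E_{K,k} are formed by the remaining terms" -/

/-- **(1.28)** p. 418 [PDF 8]: *"We substitute it [(1.27)] in δm²_K(x), E_K and we get the following decomposition
δm²_K(x) = δm²_{K,k}(x) + δm²_k(x), E_K = E_{K,k} + E_k, (1.28) where δm²_k(x), E_k have the same form as δm²_K(x),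
E_K, only the propagators are replaced by G^ε_k(0), G^ε_k correspondingly, and δm²_{K,k}(x), E_{K,k} are formed by
the remaining terms."*  Typed reading (as in `B3.sum_multiIndex`): a graph expression is a map `E` MULTILINEAR in the
family of the propagators of its lines `ι`; substituting `GK l = Gk l + GKk l` on every line `l`, the term with `Gk`
on ALL lines splits off and the remaining terms are the `2^|ι| − 1` terms in which at least one line carries the tail
`GKk`.  PROVED (kernel: `MultilinearMap.map_add_univ`). [cite: Balaban1983Higgs3, (1.28) p.418] -/
theorem eq128 {S ι V W : Type*} [CommSemiring S] [AddCommGroup V] [AddCommGroup W] [Module S V] [Module S W]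
    [Fintype ι] [DecidableEq ι] (E : MultilinearMap S (fun _ : ι => V) W) (Gk GKk : ι → V) :
    E (Gk + GKk) = E Gk + ∑ s ∈ (Finset.univ : Finset (Finset ι)).erase Finset.univ, E (s.piecewise Gk GKk) := by
  classical
  rw [MultilinearMap.map_add_univ, ← Finset.add_sum_erase _ _ (Finset.mem_univ (Finset.univ : Finset ι))]
  simp [Finset.piecewise_univ]

/-! ### (1.32) — the norm ‖·‖_{1,α} -/

section Norm132

open LatticeNorms

variable {ι κ E : Type*} [SeminormedAddCommGroup E]

/-- **(1.32)** p. 420 [PDF 10]: *"For a scalar field f of one variable we define ‖f‖_{1,α} = sup_x |f(x)| +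
sup_{x,μ} |(D^η_{B,μ}f)(x)| + sup_{x,x′,μ} |x − x′|^{−α} |U(B(Γ_{x,x′}))(D^η_{B,μ}f)(x′) − (D^η_{B,μ}f)(x)|, (1.32)
where Γ_{x,x′} is a shortest contour connecting x and x′. This definition extends in a natural way to functions of
many variables. For external vector fields we have the same definition, but with B = 0."*  The printed SUM form over
the shared ingredients of `LatticeNorms`: `f` on the sites `S`, its covariant derivatives `Df` on the index set `SD` of
pairs (μ, x), `sameDir`/`distD`/`τ` = same μ / |x − x′| / the transport U(B(Γ_{x,x′})) — all supplied, exactly as in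
`LatticeNorms.holderNormOne` (B4 (2.14), MAX form). [cite: Balaban1983Higgs3, (1.32) p.420] -/
noncomputable def norm132 (α : ℝ) (sameDir : κ → κ → Prop) (distD : κ → κ → ℝ) (τ : κ → κ → E → E)
    (S : Finset ι) (SD : Finset κ) (f : ι → E) (Df : κ → E) : ℝ :=
  supNorm S f + supNorm SD Df + holderSeminorm α sameDir distD τ SD Df

/-- (1.32) is nonnegative. [cite: Balaban1983Higgs3, (1.32) p.420] -/
theorem norm132_nonneg (α : ℝ) (sameDir : κ → κ → Prop) (distD : κ → κ → ℝ) (τ : κ → κ → E → E)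
    (S : Finset ι) (SD : Finset κ) (f : ι → E) (Df : κ → E) :
    0 ≤ norm132 α sameDir distD τ S SD f Df :=
  add_nonneg (add_nonneg (supNorm_nonneg S f) (supNorm_nonneg SD Df)) (holderSeminorm_nonneg α sameDir distD τ SD Df)

/-- The MAX form `LatticeNorms.holderNormOne` (B4 (2.14)) is dominated by the printed SUM form (1.32).
[cite: Balaban1983Higgs3, (1.32) p.420] -/
theorem holderNormOne_le_norm132 (α : ℝ) (sameDir : κ → κ → Prop) (distD : κ → κ → ℝ) (τ : κ → κ → E → E)
    (S : Finset ι) (SD : Finset κ) (f : ι → E) (Df : κ → E) :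
    holderNormOne α sameDir distD τ S SD f Df ≤ norm132 α sameDir distD τ S SD f Df := by
  have h1 := supNorm_nonneg S f
  have h2 := supNorm_nonneg SD Df
  have h3 := holderSeminorm_nonneg α sameDir distD τ SD Df
  unfold holderNormOne norm132
  refine max_le ?_ (max_le ?_ ?_) <;> linarith

/-- Conversely the SUM form (1.32) is at most three times the MAX form. [cite: Balaban1983Higgs3, (1.32) p.420] -/
theorem norm132_le_three_mul_holderNormOne (α : ℝ) (sameDir : κ → κ → Prop) (distD : κ → κ → ℝ)
    (τ : κ → κ → E → E) (S : Finset ι) (SD : Finset κ) (f : ι → E) (Df : κ → E) :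
    norm132 α sameDir distD τ S SD f Df ≤ 3 * holderNormOne α sameDir distD τ S SD f Df := by
  have h1 : supNorm S f ≤ holderNormOne α sameDir distD τ S SD f Df := le_max_left _ _
  have h2 : supNorm SD Df ≤ holderNormOne α sameDir distD τ S SD f Df :=
    (le_max_left _ _).trans (le_max_right _ _)
  have h3 : holderSeminorm α sameDir distD τ SD Df ≤ holderNormOne α sameDir distD τ S SD f Df :=
    (le_max_right _ _).trans (le_max_right _ _)
  unfold norm132
  linarith

end Norm132

end Literature.MathematicalPhysics.QuantumFieldTheory.Balaban1983to89.B3Sect1Statements
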